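import Summits.QuantumAdvantage.QuantumAdvantage.Statement
import Summits.QuantumAdvantage.QuantumAdvantage.Theorems.SoloBlindCeiling
import Literature.Computability.Complexity.ExpTimeCollapsesProofs
import Literature.Computability.Complexity.CircuitClassesUniformProofs
import Literature.Computability.Complexity.EquivalenceProblemsCollapseProofs
import Literature.Computability.Complexity.ExpClosure
import Literature.Computability.Complexity.PolyHierarchy
import HarnessLib

/-!
# `QuantumAdvantage`: the Karp–Lipton splitting of the ceiling, and where it stops

Companion of `SoloBlindCeiling.lean` (which proves `QuantumAdvantage → ¬ EXP ⊆ BPP`). Over the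
tree's *discharged* facts

* Adleman's theorem `BPP ⊆ P/poly` (`BPP_subset_PPoly_holds`; Arora–Barak 2009, Thm. 7.14),
* Meyer's theorem `EXP ⊆ P/poly → EXP = Σ₂ᵖ` (`EXP_eq_SigmaP_two_of_subset_PPoly_holds`;
  Karp–Lipton 1980, Arora–Barak 2009, Thm. 6.20),
* Zachos' collapse `NP ⊆ BPP → PH ⊆ BPP` (`PH_subset_BPP_of_NP_subset_BPP`; Zachos 1988),
* `NP ⊆ EXP` (`NP_subset_EXP_holds`), `Σ₂ᵖ ⊆ PH` (`SigmaP_subset_PH`), `BPP ⊆ Σ₂ᵖ`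
  (`BPP_subset_SigmaP_two`, Sipser–Gács–Lautemann),

this file records, sorry-free and with NO undischarged hypothesis, the non-uniform/uniform
splitting of the ceiling consequence `EXP ⊄ BPP`:

* `soloBlind_EXP_subset_BPP_iff_split : EXP ⊆ BPP ↔ (EXP ⊆ P/poly ∧ NP ⊆ BPP)`;
* `soloBlind_karpLipton_split : QuantumAdvantage → ¬ EXP ⊆ P/poly ∨ ¬ NP ⊆ BPP` — any proof of
  the summit proves, a fortiori, that `EXP` needs superpolynomial circuits or that `SAT ∉ BPP`
  (in print the same splitting holds for `PSPACE` (Karp–Lipton 1980; Arora–Barak Thm. 8.22) and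
  for `PP` / `P^{#P}` (LFKN 1992, Vinodchandran 2005) in place of `EXP`; the tree discharges the
  `EXP` case);
* the two corner readings: in the (unrefuted) world `NP ⊆ BPP` the summit is *exactly*
  `BQP ⊄ PH` and forces `EXP ⊄ P/poly`; in the (unrefuted) world `EXP ⊆ P/poly` the summit
  forces `NP ⊄ BPP`, hence `P ≠ NP`;
* the non-uniform half at `BQP` itself: `¬ BQP ⊆ P/poly → QuantumAdvantage` (Adleman), the
  tautological split `QuantumAdvantage ↔ ¬ BQP ⊆ P/poly ∨ (BQP ⊆ P/poly ∧ ¬ BQP ⊆ BPP)`, and the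
  SHAPE of the theorem that is missing: a Karp–Lipton theorem *for* `BQP`
  (`BQP ⊆ P/poly → BQP ⊆ PH`) would turn the summit into `¬ BQP ⊆ P/poly ∨ ¬ NP ⊆ BPP`. No such
  theorem is known — every quantum Karp–Lipton theorem in print has the quantum class on the
  right of `⊆` (`NP ⊆ BQP/qpoly`, `PrQCMA ⊆ BQP/mpoly`, `PP ⊆ BQP/qpoly`: Aaronson–Drucker 2014,
  Aaronson–Cojocaru–Gheorghiu–Kashefi 2017, Gharibian–Santha–Sikora–Sundaram–Yirka 2022 Thm. 1.8,
  Aaronson 2006), because `BQP` has no known self-reducible or classically checkable complete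
  language; even `BQP ⊆ P/poly` is open (it follows from `¬ QuantumAdvantage`).

Nothing here is progress towards the summit: the disjunction in `soloBlind_karpLipton_split` is
EQUIVALENT to the ceiling consequence `¬ EXP ⊆ BPP`, open and relativization-blocked (relative to
the Beigel–Buhrman–Fortnow 1998 oracle `EXP = BPP`, as quoted in Fortnow–Santhanam–Williams 2009,
p. 7). It is the kernel-checked form of one more sentence of the wall: a proof of the summit is a
superpolynomial circuit lower bound for `EXP` (indeed `PP`) unless it is also a proof of
`SAT ∉ BPP`.

References: R. Karp, R. Lipton, STOC 1980 (Meyer's theorem); L. Adleman, FOCS 1978; S. Zachos,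
JCSS 36 (1988); S. Arora, B. Barak, *Computational Complexity* (2009), Thms. 6.20, 7.14, 8.22;
S. Gharibian, M. Santha, J. Sikora, A. Sundaram, J. Yirka, comput. complex. 31 (2022),
arXiv:1805.11139, Thm. 1.8 and §1.2; S. Aaronson, *Oracles are subtle but not malicious*, CCC 2006,
arXiv:cs/0504048, §1; L. Fortnow, R. Santhanam, R. Williams, CCC 2009, p. 7.
-/

namespace Summit.QuantumAdvantage.QuantumAdvantage.Theorems

open Literature.Computability.Complexity Literature.Computability.Complexity.Classes
  Literature.Computability.Cryptography Literature.Computability.QuantumComplexity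

/-! ### The splitting of `EXP ⊆ BPP` -/

/-- **`EXP ⊆ BPP ↔ (EXP ⊆ P/poly ∧ NP ⊆ BPP)`.** `→`: Adleman and `NP ⊆ EXP`. `←`: Meyer's
theorem gives `EXP = Σ₂ᵖ ⊆ PH`, and Zachos' collapse gives `PH ⊆ BPP`. All four facts are
discharged in the tree. [cite: AroraBarakCC2009, Thm. 6.20, Thm. 7.14] -/
theorem soloBlind_EXP_subset_BPP_iff_split :
    EXP ⊆ BPP ↔ (EXP ⊆ PPoly ∧ Nondeterministic.NP ⊆ BPP) := by
  constructor
  · intro h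
    exact ⟨h.trans BPP_subset_PPoly_holds, fun L hL => h (NP_subset_EXP_holds hL)⟩
  · rintro ⟨hE, hN⟩
    rw [EXP_eq_SigmaP_two_of_subset_PPoly_holds hE]
    exact (SigmaP_subset_PH 2).trans (PH_subset_BPP_of_NP_subset_BPP hN)

/-- **The Karp–Lipton splitting of the ceiling.** Any proof of `QuantumAdvantage` proves that
`EXP` has no polynomial-size circuits or that `NP ⊄ BPP`. (Via `SoloBlindCeiling`'s
`QuantumAdvantage → ¬ EXP ⊆ BPP` and the splitting above.) -/
theorem soloBlind_karpLipton_split (h : _root_.QuantumAdvantage) :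
    ¬ (EXP ⊆ PPoly) ∨ ¬ (Nondeterministic.NP ⊆ BPP) := by
  by_contra hc
  push Not at hc
  exact soloBlind_not_EXP_subset_BPP h (soloBlind_EXP_subset_BPP_iff_split.2 hc)

/-- Corner reading 1: in the world `NP ⊆ BPP` (unrefuted), the summit forces a superpolynomial
circuit lower bound for `EXP`. -/
theorem soloBlind_not_EXP_subset_PPoly_of_NP_subset_BPP (h : _root_.QuantumAdvantage)
    (hN : Nondeterministic.NP ⊆ BPP) : ¬ (EXP ⊆ PPoly) :=
  (soloBlind_karpLipton_split h).resolve_right (not_not.2 hN)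

/-- Corner reading 1, sharpened: in the world `NP ⊆ BPP` one has `PH = BPP` (Zachos +
Sipser–Gács–Lautemann), so the summit is *exactly* the unrelativised Raz–Tal statement
`BQP ⊄ PH`. -/
theorem soloBlind_iff_not_BQP_subset_PH_of_NP_subset_BPP (hN : Nondeterministic.NP ⊆ BPP) :
    _root_.QuantumAdvantage ↔ ¬ (BQP ⊆ PH) := by
  rw [soloBlind_quantumAdvantage_iff_not_subset, PH_eq_BPP_of_NP_subset_BPP hN]

/-- Corner reading 2: in the world `EXP ⊆ P/poly` (unrefuted), the summit forces `NP ⊄ BPP`. -/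
theorem soloBlind_not_NP_subset_BPP_of_EXP_subset_PPoly (h : _root_.QuantumAdvantage)
    (hE : EXP ⊆ PPoly) : ¬ (Nondeterministic.NP ⊆ BPP) :=
  (soloBlind_karpLipton_split h).resolve_left (not_not.2 hE)

/-- Corner reading 2, continued: in the world `EXP ⊆ P/poly` the summit forces `P ≠ NP`
(`P ⊆ BPP` is the tree's `P_subset_BPP_holds`). -/
theorem soloBlind_P_ne_NP_of_EXP_subset_PPoly (h : _root_.QuantumAdvantage)
    (hE : EXP ⊆ PPoly) : P ≠ Nondeterministic.NP := fun hPNP =>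
  soloBlind_not_NP_subset_BPP_of_EXP_subset_PPoly h hE (hPNP ▸ P_subset_BPP_holds)

/-! ### The non-uniform half at `BQP` itself, and the shape of the missing theorem -/

/-- **`BQP ⊄ P/poly → QuantumAdvantage`** (Adleman: `BPP ⊆ P/poly`, discharged). The non-uniform
statement is a circuit lower bound (subject to the natural-proofs barrier) and is itself open:
`BQP ⊆ P/poly` follows from `¬ QuantumAdvantage`. [cite: AroraBarakCC2009, Thm. 7.14] -/
theorem soloBlind_of_not_BQP_subset_PPoly (h : ¬ (BQP ⊆ PPoly)) : _root_.QuantumAdvantage :=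
  soloBlind_quantumAdvantage_iff_not_subset.2 fun hB => h (hB.trans BPP_subset_PPoly_holds)

/-- `¬ QuantumAdvantage → BQP ⊆ P/poly`: uniform classical simulability gives non-uniform
simulability. -/
theorem soloBlind_BQP_subset_PPoly_of_not (h : ¬ _root_.QuantumAdvantage) : BQP ⊆ PPoly :=
  (not_not.1 ((not_congr soloBlind_quantumAdvantage_iff_not_subset).1 h)).trans
    BPP_subset_PPoly_holds

/-- The tautological split of the summit at `BQP`: either `BQP` needs superpolynomial circuits,
or quantum polynomial time is non-uniformly but not uniformly classically simulable. -/
theorem soloBlind_split_at_BQP :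
    _root_.QuantumAdvantage ↔ ¬ (BQP ⊆ PPoly) ∨ (BQP ⊆ PPoly ∧ ¬ (BQP ⊆ BPP)) := by
  rw [soloBlind_quantumAdvantage_iff_not_subset]
  constructor
  · intro h
    by_cases hP : BQP ⊆ PPoly
    · exact Or.inr ⟨hP, h⟩
    · exact Or.inl hP
  · rintro (hP | ⟨-, h⟩)
    · exact fun hB => hP (hB.trans BPP_subset_PPoly_holds)
    · exact h

/-- **The shape of the missing theorem.** A Karp–Lipton theorem FOR `BQP` — "`BQP ⊆ P/poly`
collapses `BQP` into the polynomial hierarchy", the analogue of Meyer's theorem for `EXP` and of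
Karp–Lipton's for `PSPACE` — would make the summit the disjunction of a circuit lower bound for
`BQP` and `NP ⊄ BPP`. No such theorem is known (every quantum Karp–Lipton theorem in print has the
quantum class as the simulating class, not the simulated one); the hypothesis `hKL` names it.
[cite: GharibianEtAl2022, Thm. 1.8, §1.2] -/
theorem soloBlind_split_of_karpLipton_for_BQP (hKL : BQP ⊆ PPoly → BQP ⊆ PH)
    (h : _root_.QuantumAdvantage) : ¬ (BQP ⊆ PPoly) ∨ ¬ (Nondeterministic.NP ⊆ BPP) := by
  by_contra hc
  push Not at hc
  exact (soloBlind_quantumAdvantage_iff_not_subset.1 h)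
    ((hKL hc.1).trans (PH_subset_BPP_of_NP_subset_BPP hc.2))

/-- Conversely such a Karp–Lipton theorem for `BQP` holds trivially in the world `¬ QuantumAdvantage`
(then `BQP ⊆ BPP ⊆ Σ₂ᵖ ⊆ PH`), so it cannot be refuted without proving the summit. -/
theorem soloBlind_karpLipton_for_BQP_of_not (h : ¬ _root_.QuantumAdvantage) :
    BQP ⊆ PPoly → BQP ⊆ PH := fun _ =>
  (not_not.1 ((not_congr soloBlind_quantumAdvantage_iff_not_subset).1 h)).trans
    (BPP_subset_SigmaP_two.trans (SigmaP_subset_PH 2))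


end Summit.QuantumAdvantage.QuantumAdvantage.Theorems
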